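import Summits.CriticalPhenomena.PercolationContinuityZ3.Theorems.PercNearOneGluingNoHeavyLowerTailSahiE4ProductFormula
import Summits.CriticalPhenomena.PercolationContinuityZ3.Theorems.PercNearOneGluingNoHeavyLowerTailSahiE3ProductClosure
import Literature.Combinatorics.Sahi2008.ProvedCases
import Mathlib.Tactic.Linarith
import Mathlib.Tactic.Ring
import HarnessLib
import HarnessLib.Audit

/-!
# `NoHeavyLowerTail` (crux stmt-CriticalPhenomena-4575), Sahi programme P4: `E₄ ≥ 0` FOR RECTANGLE QUADRUPLES ON A PRODUCT OF TWO
# SAHI-POSITIVE SPACES (order-4 closure under independent products, measure level), unconditional on `2^X × 2^Y`, `|X|,|Y| ≤ 2`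

Support file (cell `prim-l12`, seat P4, generation 31; `--supports stmt-CriticalPhenomena-4575`).  No named facts, no sorries;
standard axioms; def-free.

THEOREM `sahiE_four_rect_nonneg`.  `L, M` finite preorders with real weights `ν_B, ν_Q` that are Sahi-positive of orders
`1, 2, 3, 4` (`Literature.Combinatorics.Sahi2008.SahiPositive`); `w(b,t) = ν_B(b)ν_Q(t)` on `L × M`; up-sets `A,B,C,D ⊆ L`,
`A′,B′,C′,D′ ⊆ M`.  Then Sahi's `E₄` (the tree's recursively defined `sahiE w 4`) of the four rectangle indicators
`1_{A×A′}, 1_{B×B′}, 1_{C×C′}, 1_{D×D′}` is `≥ 0`.  Proof: the joint moments of rectangles are products of the factor moments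
(`…SahiE3ProductClosure.mass_rect`), so `E₄` is the left-hand side of the order-4 PRODUCT FORMULA
`…SahiE4ProductFormula.sahiE4_product_nonneg`, whose thirty hypotheses are Sahi functionals of orders `≤ 4` of indicator
sub-families on `L` and of MERGED indicator families (indicators of intersections of up-sets) on `M` — all instances of the assumed
Sahi positivity.  COROLLARY `sahiE_four_rect_nonneg_twoPoint`: unconditional for `L = 2^X`, `M = 2^Y` with `|X|, |Y| ≤ 2` and ANY
two FKG probability weights ([Sahi2008, Prop. 15] = `SahiTwoPointLatticeTheorem_holds`): an order-4 instance of Sahi's conjecture on the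
16×16-point lattice `2^X × 2^Y` for non-product (block-FKG) weights and non-cumulation functions — outside both [Sahi2008, Thm. 2] and
[LiebSahi2021, Thm. 3.5].  The general statement (all orders, all Sahi-positive blocks) is proved on paper in HOME memo prim-l12-p4
gen 31 §PF. [this work]
-/

namespace Summit.CriticalPhenomena.PercolationContinuityZ3.Theorems.SahiE4RectClosure

open Finset Literature.Probability.LatticeModels Literature.Combinatorics.Sahi2008 SahiE3ProductClosure SahiE4ProductFormula
open scoped BigOperators

/-- **`E₄ ≥ 0` for rectangle quadruples on a product of two Sahi-positive spaces** (see the module docstring). [this work] -/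
theorem sahiE_four_rect_nonneg {L M : Type*} [Preorder L] [Fintype L] [DecidableEq L] [Preorder M] [Fintype M] [DecidableEq M]
    (νB : L → ℝ) (νQ : M → ℝ)
    (hB1 : SahiPositive νB 1) (hB2 : SahiPositive νB 2) (hB3 : SahiPositive νB 3) (hB4 : SahiPositive νB 4)
    (hQ1 : SahiPositive νQ 1) (hQ2 : SahiPositive νQ 2) (hQ3 : SahiPositive νQ 3) (hQ4 : SahiPositive νQ 4)
    (w : L × M → ℝ) (hw : ∀ x, w x = νB x.1 * νQ x.2)
    (A B C D : Finset L) (A' B' C' D' : Finset M)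
    (hu1 : IsUpperSet (A : Set L)) (hu2 : IsUpperSet (B : Set L)) (hu3 : IsUpperSet (C : Set L)) (hu4 : IsUpperSet (D : Set L))
    (hv1 : IsUpperSet (A' : Set M)) (hv2 : IsUpperSet (B' : Set M)) (hv3 : IsUpperSet (C' : Set M)) (hv4 : IsUpperSet (D' : Set M)) :
    0 ≤ sahiE w 4 ![setInd (A ×ˢ A'), setInd (B ×ˢ B'), setInd (C ×ˢ C'), setInd (D ×ˢ D')] := by
  have up_y12 : IsUpperSet ((A' ∩ B' : Finset M) : Set M) := by
    simp only [Finset.coe_inter]; exact (hv1.inter hv2)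
  have up_y13 : IsUpperSet ((A' ∩ C' : Finset M) : Set M) := by
    simp only [Finset.coe_inter]; exact (hv1.inter hv3)
  have up_y14 : IsUpperSet ((A' ∩ D' : Finset M) : Set M) := by
    simp only [Finset.coe_inter]; exact (hv1.inter hv4)
  have up_y23 : IsUpperSet ((B' ∩ C' : Finset M) : Set M) := by
    simp only [Finset.coe_inter]; exact (hv2.inter hv3)
  have up_y24 : IsUpperSet ((B' ∩ D' : Finset M) : Set M) := by
    simp only [Finset.coe_inter]; exact (hv2.inter hv4)
  have up_y34 : IsUpperSet ((C' ∩ D' : Finset M) : Set M) := by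
    simp only [Finset.coe_inter]; exact (hv3.inter hv4)
  have up_y123 : IsUpperSet ((A' ∩ B' ∩ C' : Finset M) : Set M) := by
    simp only [Finset.coe_inter]; exact ((hv1.inter hv2).inter hv3)
  have up_y124 : IsUpperSet ((A' ∩ B' ∩ D' : Finset M) : Set M) := by
    simp only [Finset.coe_inter]; exact ((hv1.inter hv2).inter hv4)
  have up_y134 : IsUpperSet ((A' ∩ C' ∩ D' : Finset M) : Set M) := by
    simp only [Finset.coe_inter]; exact ((hv1.inter hv3).inter hv4)
  have up_y234 : IsUpperSet ((B' ∩ C' ∩ D' : Finset M) : Set M) := by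
    simp only [Finset.coe_inter]; exact ((hv2.inter hv3).inter hv4)
  have up_y1234 : IsUpperSet ((A' ∩ B' ∩ C' ∩ D' : Finset M) : Set M) := by
    simp only [Finset.coe_inter]; exact (((hv1.inter hv2).inter hv3).inter hv4)
  have hx1_raw : 0 ≤ sahiE νB 1 ![setInd A] := hB1 ![setInd A]
      (by intro i x; fin_cases i; exact setInd_nonneg _ _)
      (by intro i; fin_cases i; exact monotone_setInd hu1)
  rw [sahiE_one] at hx1_raw; simp only [ex_setInd] at hx1_raw
  have hx2_raw : 0 ≤ sahiE νB 1 ![setInd B] := hB1 ![setInd B]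
      (by intro i x; fin_cases i; exact setInd_nonneg _ _)
      (by intro i; fin_cases i; exact monotone_setInd hu2)
  rw [sahiE_one] at hx2_raw; simp only [ex_setInd] at hx2_raw
  have hx3_raw : 0 ≤ sahiE νB 1 ![setInd C] := hB1 ![setInd C]
      (by intro i x; fin_cases i; exact setInd_nonneg _ _)
      (by intro i; fin_cases i; exact monotone_setInd hu3)
  rw [sahiE_one] at hx3_raw; simp only [ex_setInd] at hx3_raw
  have hx4_raw : 0 ≤ sahiE νB 1 ![setInd D] := hB1 ![setInd D]
      (by intro i x; fin_cases i; exact setInd_nonneg _ _)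
      (by intro i; fin_cases i; exact monotone_setInd hu4)
  rw [sahiE_one] at hx4_raw; simp only [ex_setInd] at hx4_raw
  have hx12_raw : 0 ≤ sahiE νB 2 ![setInd A, setInd B] := hB2 ![setInd A, setInd B]
      (by intro i x; fin_cases i <;> exact setInd_nonneg _ _)
      (by intro i; fin_cases i <;> first | exact monotone_setInd hu1 | exact monotone_setInd hu2)
  rw [sahiE_two] at hx12_raw; simp only [setInd_mul, ex_setInd] at hx12_raw
  have hx13_raw : 0 ≤ sahiE νB 2 ![setInd A, setInd C] := hB2 ![setInd A, setInd C]
      (by intro i x; fin_cases i <;> exact setInd_nonneg _ _)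
      (by intro i; fin_cases i <;> first | exact monotone_setInd hu1 | exact monotone_setInd hu3)
  rw [sahiE_two] at hx13_raw; simp only [setInd_mul, ex_setInd] at hx13_raw
  have hx14_raw : 0 ≤ sahiE νB 2 ![setInd A, setInd D] := hB2 ![setInd A, setInd D]
      (by intro i x; fin_cases i <;> exact setInd_nonneg _ _)
      (by intro i; fin_cases i <;> first | exact monotone_setInd hu1 | exact monotone_setInd hu4)
  rw [sahiE_two] at hx14_raw; simp only [setInd_mul, ex_setInd] at hx14_raw
  have hx23_raw : 0 ≤ sahiE νB 2 ![setInd B, setInd C] := hB2 ![setInd B, setInd C]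
      (by intro i x; fin_cases i <;> exact setInd_nonneg _ _)
      (by intro i; fin_cases i <;> first | exact monotone_setInd hu2 | exact monotone_setInd hu3)
  rw [sahiE_two] at hx23_raw; simp only [setInd_mul, ex_setInd] at hx23_raw
  have hx24_raw : 0 ≤ sahiE νB 2 ![setInd B, setInd D] := hB2 ![setInd B, setInd D]
      (by intro i x; fin_cases i <;> exact setInd_nonneg _ _)
      (by intro i; fin_cases i <;> first | exact monotone_setInd hu2 | exact monotone_setInd hu4)
  rw [sahiE_two] at hx24_raw; simp only [setInd_mul, ex_setInd] at hx24_raw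
  have hx34_raw : 0 ≤ sahiE νB 2 ![setInd C, setInd D] := hB2 ![setInd C, setInd D]
      (by intro i x; fin_cases i <;> exact setInd_nonneg _ _)
      (by intro i; fin_cases i <;> first | exact monotone_setInd hu3 | exact monotone_setInd hu4)
  rw [sahiE_two] at hx34_raw; simp only [setInd_mul, ex_setInd] at hx34_raw
  have hx123_raw : 0 ≤ sahiE νB 3 ![setInd A, setInd B, setInd C] := hB3 ![setInd A, setInd B, setInd C]
      (by intro i x; fin_cases i <;> exact setInd_nonneg _ _)
      (by intro i; fin_cases i <;> first | exact monotone_setInd hu1 | exact monotone_setInd hu2 | exact monotone_setInd hu3)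
  rw [sahiE_three] at hx123_raw; simp only [setInd_mul, ex_setInd] at hx123_raw
  have hx124_raw : 0 ≤ sahiE νB 3 ![setInd A, setInd B, setInd D] := hB3 ![setInd A, setInd B, setInd D]
      (by intro i x; fin_cases i <;> exact setInd_nonneg _ _)
      (by intro i; fin_cases i <;> first | exact monotone_setInd hu1 | exact monotone_setInd hu2 | exact monotone_setInd hu4)
  rw [sahiE_three] at hx124_raw; simp only [setInd_mul, ex_setInd] at hx124_raw
  have hx134_raw : 0 ≤ sahiE νB 3 ![setInd A, setInd C, setInd D] := hB3 ![setInd A, setInd C, setInd D]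
      (by intro i x; fin_cases i <;> exact setInd_nonneg _ _)
      (by intro i; fin_cases i <;> first | exact monotone_setInd hu1 | exact monotone_setInd hu3 | exact monotone_setInd hu4)
  rw [sahiE_three] at hx134_raw; simp only [setInd_mul, ex_setInd] at hx134_raw
  have hx234_raw : 0 ≤ sahiE νB 3 ![setInd B, setInd C, setInd D] := hB3 ![setInd B, setInd C, setInd D]
      (by intro i x; fin_cases i <;> exact setInd_nonneg _ _)
      (by intro i; fin_cases i <;> first | exact monotone_setInd hu2 | exact monotone_setInd hu3 | exact monotone_setInd hu4)
  rw [sahiE_three] at hx234_raw; simp only [setInd_mul, ex_setInd] at hx234_raw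
  have hx1234_raw : 0 ≤ sahiE νB 4 ![setInd A, setInd B, setInd C, setInd D] := hB4 ![setInd A, setInd B, setInd C, setInd D]
      (by intro i x; fin_cases i <;> exact setInd_nonneg _ _)
      (by intro i; fin_cases i <;> first | exact monotone_setInd hu1 | exact monotone_setInd hu2 | exact monotone_setInd hu3 | exact monotone_setInd hu4)
  rw [sahiE_four] at hx1234_raw; simp only [setInd_mul, ex_setInd] at hx1234_raw
  have hy_1_2_3_4_raw : 0 ≤ sahiE νQ 4 ![setInd A', setInd B', setInd C', setInd D'] := hQ4 ![setInd A', setInd B', setInd C', setInd D']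
      (by intro i x; fin_cases i <;> exact setInd_nonneg _ _)
      (by intro i; fin_cases i <;> first | exact monotone_setInd hv1 | exact monotone_setInd hv2 | exact monotone_setInd hv3 | exact monotone_setInd hv4)
  rw [sahiE_four] at hy_1_2_3_4_raw; simp only [setInd_mul, ex_setInd] at hy_1_2_3_4_raw
  have hy_1_2_34_raw : 0 ≤ sahiE νQ 3 ![setInd A', setInd B', setInd (C' ∩ D')] := hQ3 ![setInd A', setInd B', setInd (C' ∩ D')]
      (by intro i x; fin_cases i <;> exact setInd_nonneg _ _)
      (by intro i; fin_cases i <;> first | exact monotone_setInd hv1 | exact monotone_setInd hv2 | exact monotone_setInd up_y34)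
  have e_y_hy_1_2_34_1234 : (A' ∩ B' ∩ (C' ∩ D') : Finset M) = A' ∩ B' ∩ C' ∩ D' := by ext z; simp only [Finset.mem_inter]; tauto
  have e_y_hy_1_2_34_234 : (B' ∩ (C' ∩ D') : Finset M) = B' ∩ C' ∩ D' := by ext z; simp only [Finset.mem_inter]; tauto
  have e_y_hy_1_2_34_134 : (A' ∩ (C' ∩ D') : Finset M) = A' ∩ C' ∩ D' := by ext z; simp only [Finset.mem_inter]; tauto
  rw [sahiE_three] at hy_1_2_34_raw; simp only [setInd_mul, ex_setInd] at hy_1_2_34_raw; rw [e_y_hy_1_2_34_1234, e_y_hy_1_2_34_234, e_y_hy_1_2_34_134] at hy_1_2_34_raw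
  have hy_1_23_4_raw : 0 ≤ sahiE νQ 3 ![setInd A', setInd (B' ∩ C'), setInd D'] := hQ3 ![setInd A', setInd (B' ∩ C'), setInd D']
      (by intro i x; fin_cases i <;> exact setInd_nonneg _ _)
      (by intro i; fin_cases i <;> first | exact monotone_setInd hv1 | exact monotone_setInd up_y23 | exact monotone_setInd hv4)
  have e_y_hy_1_23_4_1234 : (A' ∩ (B' ∩ C') ∩ D' : Finset M) = A' ∩ B' ∩ C' ∩ D' := by ext z; simp only [Finset.mem_inter]; tauto
  have e_y_hy_1_23_4_123 : (A' ∩ (B' ∩ C') : Finset M) = A' ∩ B' ∩ C' := by ext z; simp only [Finset.mem_inter]; tauto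
  rw [sahiE_three] at hy_1_23_4_raw; simp only [setInd_mul, ex_setInd] at hy_1_23_4_raw; rw [e_y_hy_1_23_4_1234, e_y_hy_1_23_4_123] at hy_1_23_4_raw
  have hy_1_24_3_raw : 0 ≤ sahiE νQ 3 ![setInd A', setInd (B' ∩ D'), setInd C'] := hQ3 ![setInd A', setInd (B' ∩ D'), setInd C']
      (by intro i x; fin_cases i <;> exact setInd_nonneg _ _)
      (by intro i; fin_cases i <;> first | exact monotone_setInd hv1 | exact monotone_setInd up_y24 | exact monotone_setInd hv3)
  have e_y_hy_1_24_3_1243 : (A' ∩ (B' ∩ D') ∩ C' : Finset M) = A' ∩ B' ∩ C' ∩ D' := by ext z; simp only [Finset.mem_inter]; tauto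
  have e_y_hy_1_24_3_243 : (B' ∩ D' ∩ C' : Finset M) = B' ∩ C' ∩ D' := by ext z; simp only [Finset.mem_inter]; tauto
  have e_y_hy_1_24_3_124 : (A' ∩ (B' ∩ D') : Finset M) = A' ∩ B' ∩ D' := by ext z; simp only [Finset.mem_inter]; tauto
  rw [sahiE_three] at hy_1_24_3_raw; simp only [setInd_mul, ex_setInd] at hy_1_24_3_raw; rw [e_y_hy_1_24_3_1243, e_y_hy_1_24_3_243, e_y_hy_1_24_3_124] at hy_1_24_3_raw
  have hy_12_3_4_raw : 0 ≤ sahiE νQ 3 ![setInd (A' ∩ B'), setInd C', setInd D'] := hQ3 ![setInd (A' ∩ B'), setInd C', setInd D']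
      (by intro i x; fin_cases i <;> exact setInd_nonneg _ _)
      (by intro i; fin_cases i <;> first | exact monotone_setInd up_y12 | exact monotone_setInd hv3 | exact monotone_setInd hv4)
  rw [sahiE_three] at hy_12_3_4_raw; simp only [setInd_mul, ex_setInd] at hy_12_3_4_raw
  have hy_13_2_4_raw : 0 ≤ sahiE νQ 3 ![setInd (A' ∩ C'), setInd B', setInd D'] := hQ3 ![setInd (A' ∩ C'), setInd B', setInd D']
      (by intro i x; fin_cases i <;> exact setInd_nonneg _ _)
      (by intro i; fin_cases i <;> first | exact monotone_setInd up_y13 | exact monotone_setInd hv2 | exact monotone_setInd hv4)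
  have e_y_hy_13_2_4_1324 : (A' ∩ C' ∩ B' ∩ D' : Finset M) = A' ∩ B' ∩ C' ∩ D' := by ext z; simp only [Finset.mem_inter]; tauto
  have e_y_hy_13_2_4_132 : (A' ∩ C' ∩ B' : Finset M) = A' ∩ B' ∩ C' := by ext z; simp only [Finset.mem_inter]; tauto
  rw [sahiE_three] at hy_13_2_4_raw; simp only [setInd_mul, ex_setInd] at hy_13_2_4_raw; rw [e_y_hy_13_2_4_1324, e_y_hy_13_2_4_132] at hy_13_2_4_raw
  have hy_14_2_3_raw : 0 ≤ sahiE νQ 3 ![setInd (A' ∩ D'), setInd B', setInd C'] := hQ3 ![setInd (A' ∩ D'), setInd B', setInd C']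
      (by intro i x; fin_cases i <;> exact setInd_nonneg _ _)
      (by intro i; fin_cases i <;> first | exact monotone_setInd up_y14 | exact monotone_setInd hv2 | exact monotone_setInd hv3)
  have e_y_hy_14_2_3_1423 : (A' ∩ D' ∩ B' ∩ C' : Finset M) = A' ∩ B' ∩ C' ∩ D' := by ext z; simp only [Finset.mem_inter]; tauto
  have e_y_hy_14_2_3_143 : (A' ∩ D' ∩ C' : Finset M) = A' ∩ C' ∩ D' := by ext z; simp only [Finset.mem_inter]; tauto
  have e_y_hy_14_2_3_142 : (A' ∩ D' ∩ B' : Finset M) = A' ∩ B' ∩ D' := by ext z; simp only [Finset.mem_inter]; tauto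
  rw [sahiE_three] at hy_14_2_3_raw; simp only [setInd_mul, ex_setInd] at hy_14_2_3_raw; rw [e_y_hy_14_2_3_1423, e_y_hy_14_2_3_143, e_y_hy_14_2_3_142] at hy_14_2_3_raw
  have hy_1_234_raw : 0 ≤ sahiE νQ 2 ![setInd A', setInd (B' ∩ C' ∩ D')] := hQ2 ![setInd A', setInd (B' ∩ C' ∩ D')]
      (by intro i x; fin_cases i <;> exact setInd_nonneg _ _)
      (by intro i; fin_cases i <;> first | exact monotone_setInd hv1 | exact monotone_setInd up_y234)
  have e_y_hy_1_234_1234 : (A' ∩ (B' ∩ C' ∩ D') : Finset M) = A' ∩ B' ∩ C' ∩ D' := by ext z; simp only [Finset.mem_inter]; tauto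
  rw [sahiE_two] at hy_1_234_raw; simp only [setInd_mul, ex_setInd] at hy_1_234_raw; rw [e_y_hy_1_234_1234] at hy_1_234_raw
  have hy_12_34_raw : 0 ≤ sahiE νQ 2 ![setInd (A' ∩ B'), setInd (C' ∩ D')] := hQ2 ![setInd (A' ∩ B'), setInd (C' ∩ D')]
      (by intro i x; fin_cases i <;> exact setInd_nonneg _ _)
      (by intro i; fin_cases i <;> first | exact monotone_setInd up_y12 | exact monotone_setInd up_y34)
  have e_y_hy_12_34_1234 : (A' ∩ B' ∩ (C' ∩ D') : Finset M) = A' ∩ B' ∩ C' ∩ D' := by ext z; simp only [Finset.mem_inter]; tauto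
  rw [sahiE_two] at hy_12_34_raw; simp only [setInd_mul, ex_setInd] at hy_12_34_raw; rw [e_y_hy_12_34_1234] at hy_12_34_raw
  have hy_123_4_raw : 0 ≤ sahiE νQ 2 ![setInd (A' ∩ B' ∩ C'), setInd D'] := hQ2 ![setInd (A' ∩ B' ∩ C'), setInd D']
      (by intro i x; fin_cases i <;> exact setInd_nonneg _ _)
      (by intro i; fin_cases i <;> first | exact monotone_setInd up_y123 | exact monotone_setInd hv4)
  rw [sahiE_two] at hy_123_4_raw; simp only [setInd_mul, ex_setInd] at hy_123_4_raw
  have hy_124_3_raw : 0 ≤ sahiE νQ 2 ![setInd (A' ∩ B' ∩ D'), setInd C'] := hQ2 ![setInd (A' ∩ B' ∩ D'), setInd C']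
      (by intro i x; fin_cases i <;> exact setInd_nonneg _ _)
      (by intro i; fin_cases i <;> first | exact monotone_setInd up_y124 | exact monotone_setInd hv3)
  have e_y_hy_124_3_1243 : (A' ∩ B' ∩ D' ∩ C' : Finset M) = A' ∩ B' ∩ C' ∩ D' := by ext z; simp only [Finset.mem_inter]; tauto
  rw [sahiE_two] at hy_124_3_raw; simp only [setInd_mul, ex_setInd] at hy_124_3_raw; rw [e_y_hy_124_3_1243] at hy_124_3_raw
  have hy_13_24_raw : 0 ≤ sahiE νQ 2 ![setInd (A' ∩ C'), setInd (B' ∩ D')] := hQ2 ![setInd (A' ∩ C'), setInd (B' ∩ D')]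
      (by intro i x; fin_cases i <;> exact setInd_nonneg _ _)
      (by intro i; fin_cases i <;> first | exact monotone_setInd up_y13 | exact monotone_setInd up_y24)
  have e_y_hy_13_24_1324 : (A' ∩ C' ∩ (B' ∩ D') : Finset M) = A' ∩ B' ∩ C' ∩ D' := by ext z; simp only [Finset.mem_inter]; tauto
  rw [sahiE_two] at hy_13_24_raw; simp only [setInd_mul, ex_setInd] at hy_13_24_raw; rw [e_y_hy_13_24_1324] at hy_13_24_raw
  have hy_134_2_raw : 0 ≤ sahiE νQ 2 ![setInd (A' ∩ C' ∩ D'), setInd B'] := hQ2 ![setInd (A' ∩ C' ∩ D'), setInd B']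
      (by intro i x; fin_cases i <;> exact setInd_nonneg _ _)
      (by intro i; fin_cases i <;> first | exact monotone_setInd up_y134 | exact monotone_setInd hv2)
  have e_y_hy_134_2_1342 : (A' ∩ C' ∩ D' ∩ B' : Finset M) = A' ∩ B' ∩ C' ∩ D' := by ext z; simp only [Finset.mem_inter]; tauto
  rw [sahiE_two] at hy_134_2_raw; simp only [setInd_mul, ex_setInd] at hy_134_2_raw; rw [e_y_hy_134_2_1342] at hy_134_2_raw
  have hy_14_23_raw : 0 ≤ sahiE νQ 2 ![setInd (A' ∩ D'), setInd (B' ∩ C')] := hQ2 ![setInd (A' ∩ D'), setInd (B' ∩ C')]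
      (by intro i x; fin_cases i <;> exact setInd_nonneg _ _)
      (by intro i; fin_cases i <;> first | exact monotone_setInd up_y14 | exact monotone_setInd up_y23)
  have e_y_hy_14_23_1423 : (A' ∩ D' ∩ (B' ∩ C') : Finset M) = A' ∩ B' ∩ C' ∩ D' := by ext z; simp only [Finset.mem_inter]; tauto
  rw [sahiE_two] at hy_14_23_raw; simp only [setInd_mul, ex_setInd] at hy_14_23_raw; rw [e_y_hy_14_23_1423] at hy_14_23_raw
  have hy_1234_raw : 0 ≤ sahiE νQ 1 ![setInd (A' ∩ B' ∩ C' ∩ D')] := hQ1 ![setInd (A' ∩ B' ∩ C' ∩ D')]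
      (by intro i x; fin_cases i; exact setInd_nonneg _ _)
      (by intro i; fin_cases i; exact monotone_setInd up_y1234)
  rw [sahiE_one] at hy_1234_raw; simp only [ex_setInd] at hy_1234_raw
  -- the moments of the rectangles are products of the factor moments
  rw [sahiE_four]
  simp only [setInd_mul, Finset.product_inter_product, ex_setInd, mass_rect νB νQ w hw]
  have key := sahiE4_product_nonneg (mass νB A) (mass νB B) (mass νB C) (mass νB D) (mass νB (A ∩ B)) (mass νB (A ∩ C)) (mass νB (A ∩ D)) (mass νB (B ∩ C)) (mass νB (B ∩ D)) (mass νB (C ∩ D)) (mass νB (A ∩ B ∩ C)) (mass νB (A ∩ B ∩ D)) (mass νB (A ∩ C ∩ D)) (mass νB (B ∩ C ∩ D)) (mass νB (A ∩ B ∩ C ∩ D))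
    (mass νQ A') (mass νQ B') (mass νQ C') (mass νQ D') (mass νQ (A' ∩ B')) (mass νQ (A' ∩ C')) (mass νQ (A' ∩ D')) (mass νQ (B' ∩ C')) (mass νQ (B' ∩ D')) (mass νQ (C' ∩ D')) (mass νQ (A' ∩ B' ∩ C')) (mass νQ (A' ∩ B' ∩ D')) (mass νQ (A' ∩ C' ∩ D')) (mass νQ (B' ∩ C' ∩ D')) (mass νQ (A' ∩ B' ∩ C' ∩ D'))
    (by linarith [hx1_raw]) (by linarith [hx2_raw]) (by linarith [hx3_raw]) (by linarith [hx4_raw])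
    (by linarith [hx12_raw]) (by linarith [hx13_raw]) (by linarith [hx14_raw]) (by linarith [hx23_raw]) (by linarith [hx24_raw]) (by linarith [hx34_raw]) (by linarith [hx123_raw]) (by linarith [hx124_raw]) (by linarith [hx134_raw]) (by linarith [hx234_raw]) (by linarith [hx1234_raw]) (by linarith [hy_1_2_3_4_raw]) (by linarith [hy_1_2_34_raw]) (by linarith [hy_1_23_4_raw]) (by linarith [hy_1_24_3_raw]) (by linarith [hy_12_3_4_raw]) (by linarith [hy_13_2_4_raw]) (by linarith [hy_14_2_3_raw]) (by linarith [hy_1_234_raw]) (by linarith [hy_12_34_raw]) (by linarith [hy_123_4_raw]) (by linarith [hy_124_3_raw]) (by linarith [hy_13_24_raw]) (by linarith [hy_134_2_raw]) (by linarith [hy_14_23_raw]) (by linarith [hy_1234_raw])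
  linarith [key]

/-- **Unconditional instance: `2^X × 2^Y` with `|X|, |Y| ≤ 2`.**  For ANY two FKG probability weights on the factors (Sahi-positive of
every order by [Sahi2008, Prop. 15] = `SahiTwoPointLatticeTheorem_holds`) and all up-set factors, `E₄` of the four rectangle indicators on
the product lattice is nonnegative. [this work] -/
theorem sahiE_four_rect_nonneg_twoPoint (X Y : Type) [Fintype X] [Fintype Y] [DecidableEq (Set X)] [DecidableEq (Set Y)]
    (hX : Fintype.card X ≤ 2) (hY : Fintype.card Y ≤ 2) (νB : Set X → ℝ) (νQ : Set Y → ℝ)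
    (hB : IsFKGMeasure νB) (hQ : IsFKGMeasure νQ) (w : Set X × Set Y → ℝ) (hw : ∀ x, w x = νB x.1 * νQ x.2)
    (A B C D : Finset (Set X)) (A' B' C' D' : Finset (Set Y))
    (hu1 : IsUpperSet (A : Set (Set X))) (hu2 : IsUpperSet (B : Set (Set X))) (hu3 : IsUpperSet (C : Set (Set X)))
    (hu4 : IsUpperSet (D : Set (Set X))) (hv1 : IsUpperSet (A' : Set (Set Y))) (hv2 : IsUpperSet (B' : Set (Set Y)))
    (hv3 : IsUpperSet (C' : Set (Set Y))) (hv4 : IsUpperSet (D' : Set (Set Y))) :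
    0 ≤ sahiE w 4 ![setInd (A ×ˢ A'), setInd (B ×ˢ B'), setInd (C ×ˢ C'), setInd (D ×ˢ D')] :=
  sahiE_four_rect_nonneg νB νQ
    (SahiTwoPointLatticeTheorem_holds X hX νB hB 1) (SahiTwoPointLatticeTheorem_holds X hX νB hB 2)
    (SahiTwoPointLatticeTheorem_holds X hX νB hB 3) (SahiTwoPointLatticeTheorem_holds X hX νB hB 4)
    (SahiTwoPointLatticeTheorem_holds Y hY νQ hQ 1) (SahiTwoPointLatticeTheorem_holds Y hY νQ hQ 2)
    (SahiTwoPointLatticeTheorem_holds Y hY νQ hQ 3) (SahiTwoPointLatticeTheorem_holds Y hY νQ hQ 4)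
    w hw A B C D A' B' C' D' hu1 hu2 hu3 hu4 hv1 hv2 hv3 hv4

end Summit.CriticalPhenomena.PercolationContinuityZ3.Theorems.SahiE4RectClosure
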